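import Summits.BirchSwinnertonDyer.BirchSwinnertonDyer.Theses.GenusKolyvaginAtTwo
import Summits.BirchSwinnertonDyer.BirchSwinnertonDyer.Theses.ByReductionTypeAtTwo
import HarnessLib

/-!
# Crux `RankOneAtTwoOffBigImageOddLocal` (stmt-BirchSwinnertonDyer-23716) — ideator 2/2, gen 3: SKETCH
# «Regular Frobenius-type Kolyvagin primes at 2» (idea card `regular-frobenius-kolyvagin-primes-pos-disc`)

Typed first lemmas and the transfer statements of the card.  Nothing here is proved except the cheap
direction lemmas at the end; BSD is not proved; the crux is not proved.  `lean check` rc 0, no `sorry`.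

THE LEVER.  At `p = 2` the NUMERICAL Kolyvagin condition on an inert prime `ℓ` of level `M`
(`2^M ∣ ℓ + 1`, `2^M ∣ a_ℓ`, tree `Zhang2014.IsKolyvaginPrime` + `M ≤ kolyvaginIndex`) forces
`σ_ℓ := ρ_{E,2^M}(Frob_ℓ)` to satisfy `σ_ℓ² = 1`, `det σ_ℓ = −1`, `tr σ_ℓ = 0` (Cayley–Hamilton), but NOT its
conjugacy class: there are two `GL₂(ℤ/2^M)`-types of such involutions — DIAGONAL (`σ_ℓ ≡ 1 mod 2`,
`∼ diag(1,−1)`; this is Gross's class `Frob ℓ = Frob ∞` exactly when `Δ_E > 0`) and REGULAR (`σ_ℓ mod 2` a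
transposition, e.g. `[[1,1],[0,−1]]`; this is `Frob ∞` exactly when `Δ_E < 0`).  Every `2`-adic Kolyvagin
structure that route GenusKolyvaginAtTwo's LINE 6 needs «because `Δ < 0`» is in fact a property of the
REGULAR TYPE of the prime, available for `Δ_E > 0` curves by CHOOSING regular-type primes (a Čebotarev
class of the same size, `3·4^{M−1}` elements of `GL₂(ℤ/2^M)` for `M ≥ 3`, inside the surjective image).
-/

set_option autoImplicit false
set_option linter.dupNamespace false

noncomputable section

open scoped Classical

namespace Summit.BirchSwinnertonDyer.BirchSwinnertonDyer.Cruxes.RankOneAtTwoOffBigImageOddLocal.RegularFrobeniusPrimes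

open WeierstrassCurve NumberField IsDedekindDomain
open Literature.NumberTheory.EllipticCurves Literature.NumberTheory.GaloisRepresentations
open Summit.BirchSwinnertonDyer.BirchSwinnertonDyer.Theses.GenusKolyvaginAtTwo

/-- **Regular Frobenius type at `2`.**  Some arithmetic Frobenius at a prime of `\bar ℤ` above `ℓ` MOVES a
`2`-torsion point of `E` (i.e. `ρ̄_{E,2}(Frob_ℓ) ≠ 1`; for a Kolyvagin prime at `2` — `a_ℓ` even — this says
`ρ̄_{E,2}(Frob_ℓ)` is a transposition of `E[2] ∖ 0`, equivalently the `2`-division cubic has exactly one root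
mod `ℓ`, equivalently `E(𝔽_ℓ)[2] ≅ ℤ/2`).  Pattern of the tree predicate `FrobEqFrobInfty` (Gross (3.2)) with the
complex conjugation replaced by the one bit that matters `2`-adically. -/
def FrobNontrivialModTwo (W : WeierstrassCurve ℚ) (ℓ : ℕ) : Prop :=
  ∃ (v : HeightOneSpectrum (𝓞 ℚ)) (𝔓 : Ideal (absIntegers (𝓞 ℚ) ℚ)) (h : Field.absoluteGaloisGroup ℚ),
    (ℓ : 𝓞 ℚ) ∈ v.asIdeal ∧ 𝔓 ∈ v.primesAbove ∧ IsArithFrobAt (𝓞 ℚ) h 𝔓 ∧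
      ∃ P : W.geomTorsion 2, h • P ≠ P

/-- **R1 (first lemma, provable now / M): `E[2^M]` is cyclic over `ℤ[h]` for EVERY `h ∈ Γ_ℚ` that moves a
`2`-torsion point** — the sign-free form of Q1 `CyclicTorsionOfNegDisc` (stmt-24879, proved:
`GenusCyclicTorsion.cyclicTorsionOfNegDisc_proof`), whose proof (`GenusExact.pow_dvd_of_zsmul_add_zsmul_smul_eq_zero`,
Nakayama by hand, stated for an arbitrary group element `g`) uses of complex conjugation only `c₀ • v ≠ v` for
some `v ∈ E[2]`.  For `h = Frob_ℓ` at a regular-type Kolyvagin prime this makes `E[2^M] ≅ R_M := ℤ/2^M[⟨h⟩]`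
free of rank one — the Gorenstein structure LINE 6 runs on, now for both signs of `Δ_E`. -/
def CyclicTorsionOfRegularElement : Prop :=
  ∀ (W : WeierstrassCurve ℚ) [W.IsElliptic] (h : Field.absoluteGaloisGroup ℚ) (M : ℕ),
    (∃ v : W.geomTorsion 2, h • v ≠ v) →
      ∃ P : W.geomTorsion ((2 ^ M : ℕ) : ℤ), ∀ Q : W.geomTorsion ((2 ^ M : ℕ) : ℤ),
        ∃ a b : ℤ, Q = a • P + b • (h • P)

/-- **R2 (supply, provable now modulo the tree's Čebotarev fact / M–L): regular-type Kolyvagin primes of every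
level exist with positive density, for BOTH signs of `Δ_E`**, on the habitat of the parent crux
`KolyvaginExactAtTwo` (non-CM, `ρ_{E,2^∞}` onto, `K` imaginary quadratic off the two fields `ℚ(√−|Δ|)`,
`ℚ(√−2|Δ|)` — exactly the `K` on which a regular det `−1` involution of `GL₂(ℤ/2^M)` can act non-trivially). -/
def RegularKolyvaginPrimeSupply : Prop :=
  ∀ (N : ℕ) [NeZero N] (W : WeierstrassCurve ℚ) [W.IsElliptic] [W.IsGloballyMinimal], ¬ W.HasCM →
    ∀ (K : Type) [Field K] [NumberField K], IsImaginaryQuadratic K →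
      ¬ IsSquare ((NumberField.discr K : ℚ) * -|W.Δ|) → ¬ IsSquare ((NumberField.discr K : ℚ) * (-(2 * |W.Δ|))) →
      (∀ n : ℕ, W.HasSurjectiveModNGaloisRep (2 ^ n : ℕ)) → ∀ (M : ℕ), 1 ≤ M →
        Set.Infinite {ℓ : ℕ | Zhang2014.IsKolyvaginPrime N W K 2 ℓ ∧ M ≤ Zhang2014.kolyvaginIndex W 2 ℓ ∧
          FrobNontrivialModTwo W ℓ}

/-- **R3 = C⁺ part 1, REGULAR ČEBOTAREV AT 2 (L): Q5R `EquivariantChebotarevAtTwoR` (stmt-27280, PROVED, p606279)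
with the hypothesis `W.Δ < 0` DELETED, the binder `¬ IsSquare (d_K · (−2|Δ|))` added, and Gross's class
`FrobEqFrobInfty` in the conclusion replaced by `FrobNontrivialModTwo`** — τ-stable independent families with
prescribed local orders are realised at infinitely many REGULAR-type Kolyvagin primes of level `M`.  On `Δ < 0`
it is a corollary of p606279 (there `Frob ∞` is regular); on `Δ > 0` it is the port of p606279's proof with
`c₀ ↦ h₀ :=` any element of the image restricting to `(c, σ_reg)`, plus ONE new lemma (coset absorption
`Ĥ⁰(⟨h₀⟩, Hom(C, E[2^M])) = 0` for regular `h₀`, which replaces `c₀² = 1`). -/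
def RegularChebotarevAtTwo : Prop :=
  ∀ (N : ℕ) [NeZero N] (W : WeierstrassCurve ℚ) [W.IsElliptic] [W.IsGloballyMinimal], ¬ W.HasCM →
    ∀ (K : Type) [Field K] [NumberField K], IsImaginaryQuadratic K →
      ¬ IsSquare ((NumberField.discr K : ℚ) * -|W.Δ|) → ¬ IsSquare ((NumberField.discr K : ℚ) * (-(2 * |W.Δ|))) →
      (∀ n : ℕ, W.HasSurjectiveModNGaloisRep (2 ^ n : ℕ)) →
      ∀ (c : K ≃ₐ[ℚ] K), c ≠ 1 → ∀ (M : ℕ), 1 ≤ M →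
        ∀ (r : ℕ) (cs : Fin r → galH1Torsion (W.baseChange K) ((2 ^ M : ℕ) : ℤ)) (π : Fin r → Fin r),
          (∀ i, cs i ≠ 0) → (∀ i, conjAct W c ((2 ^ M : ℕ) : ℤ) (cs i) = cs (π i)) →
          (∀ a : Fin r → ℤ, ∑ i, a i • cs i = 0 → ∀ i, (addOrderOf (cs i) : ℤ) ∣ a i) →
          (∀ a : Fin r → ℤ, (∀ ρ ∈ torsionFixing (W.baseChange K) ((2 ^ M : ℕ) : ℤ),
              h1Eval (W.baseChange K) ((2 ^ M : ℕ) : ℤ) (∑ i, a i • cs i) ρ = 0) → ∑ i, a i • cs i = 0) →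
          ∀ (Mi : Fin r → ℕ), (∀ i, addOrderOf (cs i) = 2 ^ Mi i) → ∀ (Nv : Fin r → ℕ), (∀ i, Nv i ≤ Mi i) →
            (∀ i, Nv (π i) = Nv i) →
            Set.Infinite {ℓ : ℕ | FrobNontrivialModTwo W ℓ ∧ Zhang2014.IsKolyvaginPrime N W K 2 ℓ ∧
              M ≤ Zhang2014.kolyvaginIndex W 2 ℓ ∧
              ∀ i, ∀ v : HeightOneSpectrum (𝓞 K), (ℓ : 𝓞 K) ∈ v.asIdeal → ∀ j : ℕ,
                ((2 ^ j : ℕ) : ℤ) • cs i ∈ (W.baseChange K).torsionLocalKer (v.adicCompletion K) ((2 ^ M : ℕ) : ℤ) ↔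
                  Nv i ≤ j}

/-- **C⁺ part 2, KOLYVAGIN EXACTNESS AT 2 FROM A REGULAR WITNESS (XL, = the fate of Q2 24880 + Q3 24882, now
sign-free):** the parent crux `KolyvaginExactAtTwo` (stmt-22137) VERBATIM — no sign condition on `Δ_E` — except
that the witnessing level `n` is a product of REGULAR-type Kolyvagin primes.  Weaker than 22137 (fewer `n`);
the bet of the card is that LINE 6 (McCallum §5 run `R_M`-linearly) proves THIS statement for both signs, so that
the declared residual Q4 `KolyvaginExactAtTwoPosDisc` (stmt-24883, «TYPE C second residual» of the sibling
line) is not a residual: restrict the PRIMES, not the CURVES. -/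
def KolyvaginExactAtTwoRegular : Prop :=
  ∀ (W : WeierstrassCurve ℚ) [W.IsElliptic] [W.IsGloballyMinimal] [NeZero (W.conductorNorm ℤ)], ¬ W.HasCM →
    ∀ (K : Type) [Field K] [NumberField K], IsImaginaryQuadratic K → Odd (NumberField.discr K) →
      NumberField.discr K ≠ -3 → SatisfiesHeegnerHypothesis (W.conductorNorm ℤ) K →
      ¬ IsSquare ((NumberField.discr K : ℚ) * -|W.Δ|) → ¬ IsSquare ((NumberField.discr K : ℚ) * (-(2 * |W.Δ|))) →
      (∀ n : ℕ, 0 < n → W.HasSurjectiveModNGaloisRep ((2 : ℤ) ^ n)) →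
      ∀ (Dt : ModularForms.ModularParametrizationData W (W.conductorNorm ℤ)) (β : ℤ) (ι : K →+* ℂ)
        (d₁ : KolyvaginHeegnerData Dt β ι 1), ¬ IsOfFinAddOrder d₁.derivedPoint → ∀ (M₀ : ℕ),
        (∃ Q : (W.baseChange (ringClassField K ι 1)).toAffine.Point, ((2 ^ M₀ : ℕ) : ℤ) • Q = d₁.derivedPoint) →
        (¬ ∃ Q : (W.baseChange (ringClassField K ι 1)).toAffine.Point, ((2 ^ (M₀ + 1) : ℕ) : ℤ) • Q = d₁.derivedPoint) →
        ∀ (n : ℕ) (d : KolyvaginHeegnerData Dt β ι n), Squarefree n →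
          (∀ ℓ ∈ n.primeFactors, Zhang2014.IsKolyvaginPrime (W.conductorNorm ℤ) W K 2 ℓ ∧ FrobNontrivialModTwo W ℓ) →
          (¬ ∃ Q : (W.baseChange (ringClassField K ι n)).toAffine.Point, (2 : ℤ) • Q = d.derivedPoint) →
          Nat.card (AddCommGroup.primaryComponent (W.baseChange K).sha 2) = 2 ^ (2 * M₀)

/-- The sibling line's shift `σ(W, Dt) := v₂ ∏_ℓ c_ℓ(W) + v₂ c(Dt)` — VERBATIM copy of
`RefinedKolyvaginTamagawaShiftAtTwo.sigmaShift` (Lines/refined_kolyvagin_tamagawa_shift_at_two.lean:96; that Cruxes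
module is not part of the farm build, so it is restated here symbol for symbol). [cite: Jetchev2008, (1.3)] -/
def sigmaShift (W : WeierstrassCurve ℚ) [W.IsElliptic] [W.IsGloballyMinimal] [NeZero (W.conductorNorm ℤ)]
    (Dt : ModularForms.ModularParametrizationData W (W.conductorNorm ℤ)) : ℕ :=
  padicValNat 2 W.tamagawaProduct + padicValInt 2 Dt.c

/-- **TRANSFER for THIS crux (sibling line `refined_kolyvagin_tamagawa_shift_at_two`, stubs S4/S5): S4ʳᵉᵍ.**
`StringentPrimitivityAtTwo` VERBATIM with the witnessing level required to be a product of regular-type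
Kolyvagin primes.  Stronger than S4 as a statement, of the same strength in substance (both are the `≤` half of
`BSD₂(E/K)` read through the structure theorem); at regular primes the FIRST layer is informative already at
level `1` (toy 37a1: `y_K` is `2`-indivisible in `E(K_λ)` at 96 of 198 regular-type primes and at 0 of 63
diagonal-type ones — at a diagonal prime every `ℚ`-rational point halves in `E(𝔽_{ℓ²})`). -/
def StringentPrimitivityRegAtTwo : Prop :=
  ∀ (W : WeierstrassCurve ℚ) [W.IsElliptic] [W.IsGloballyMinimal] [NeZero (W.conductorNorm ℤ)],
    ¬ W.HasCM → (∀ n : ℕ, W.HasSurjectiveModNGaloisRep ((2 ^ n : ℕ) : ℤ)) → W.analyticRank = 1 →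
    ∀ (K : Type) [Field K] [NumberField K], IsImaginaryQuadratic K → Odd (NumberField.discr K) →
      NumberField.discr K ≠ -3 → SatisfiesHeegnerHypothesis (W.conductorNorm ℤ) K →
      ¬ IsSquare ((NumberField.discr K : ℚ) * -|W.Δ|) → ¬ IsSquare ((NumberField.discr K : ℚ) * (-(2 * |W.Δ|))) →
      ∀ (Dt : ModularForms.ModularParametrizationData W (W.conductorNorm ℤ)) (β : ℤ) (ι : K →+* ℂ)
        (d₁ : KolyvaginHeegnerData Dt β ι 1), ¬ IsOfFinAddOrder d₁.derivedPoint →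
        ∃ (n : ℕ) (d : KolyvaginHeegnerData Dt β ι n), Squarefree n ∧
          (∀ ℓ ∈ n.primeFactors, Zhang2014.IsKolyvaginPrime (W.conductorNorm ℤ) W K 2 ℓ ∧ FrobNontrivialModTwo W ℓ) ∧
          ((sigmaShift W Dt + 1 : ℕ) : ℕ∞) ≤ Zhang2014.levelIndex W 2 n ∧
          ¬ ∃ Q : (W.baseChange (ringClassField K ι n)).toAffine.Point,
            ((2 ^ (sigmaShift W Dt + 1) : ℕ) : ℤ) • Q = d.derivedPoint

/-- **TRANSFER for THIS crux: S5ʳᵉᵍ.** `ShiftedKolyvaginStructureAtTwo` VERBATIM (accumulation binder over ALL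
Kolyvagin levels kept) with the WITNESS level required to be a product of regular-type Kolyvagin primes.  Weaker
than S5; in `bsdp_two_delta` (Lines/refined…lean:886–892) S4's witness is fed straight into S5, so the pair
(S4ʳᵉᵍ, S5ʳᵉᵍ) replaces (S4, S5) with no other change — and S5ʳᵉᵍ no longer carries the «MISSTATED for Δ > 0 /
restrict by sign» risk recorded on the line card, because the regular `R_M`-mechanism is sign-blind. -/
def ShiftedKolyvaginStructureRegAtTwo : Prop :=
  ∀ (W : WeierstrassCurve ℚ) [W.IsElliptic] [W.IsGloballyMinimal] [NeZero (W.conductorNorm ℤ)],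
    ¬ W.HasCM → (∀ n : ℕ, W.HasSurjectiveModNGaloisRep ((2 ^ n : ℕ) : ℤ)) →
    ∀ (K : Type) [Field K] [NumberField K], IsImaginaryQuadratic K → Odd (NumberField.discr K) →
      NumberField.discr K ≠ -3 → SatisfiesHeegnerHypothesis (W.conductorNorm ℤ) K →
      ¬ IsSquare ((NumberField.discr K : ℚ) * -|W.Δ|) → ¬ IsSquare ((NumberField.discr K : ℚ) * (-(2 * |W.Δ|))) →
      ∀ (Dt : ModularForms.ModularParametrizationData W (W.conductorNorm ℤ)) (β : ℤ) (ι : K →+* ℂ)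
        (d₁ : KolyvaginHeegnerData Dt β ι 1), ¬ IsOfFinAddOrder d₁.derivedPoint →
        ∀ (M₀ : ℕ), (∃ Q : (W.baseChange (ringClassField K ι 1)).toAffine.Point, ((2 ^ M₀ : ℕ) : ℤ) • Q = d₁.derivedPoint) →
          (¬ ∃ Q : (W.baseChange (ringClassField K ι 1)).toAffine.Point, ((2 ^ (M₀ + 1) : ℕ) : ℤ) • Q = d₁.derivedPoint) →
          (∀ (n : ℕ) (d : KolyvaginHeegnerData Dt β ι n) (m : ℕ), Squarefree n →
              (∀ ℓ ∈ n.primeFactors, Zhang2014.IsKolyvaginPrime (W.conductorNorm ℤ) W K 2 ℓ) →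
              (m : ℕ∞) ≤ Zhang2014.levelIndex W 2 n → m ≤ sigmaShift W Dt →
              ∃ Q : (W.baseChange (ringClassField K ι n)).toAffine.Point, ((2 ^ m : ℕ) : ℤ) • Q = d.derivedPoint) →
          ∀ (n : ℕ) (d : KolyvaginHeegnerData Dt β ι n), Squarefree n →
            (∀ ℓ ∈ n.primeFactors, Zhang2014.IsKolyvaginPrime (W.conductorNorm ℤ) W K 2 ℓ ∧ FrobNontrivialModTwo W ℓ) →
            ((sigmaShift W Dt + 1 : ℕ) : ℕ∞) ≤ Zhang2014.levelIndex W 2 n →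
            (¬ ∃ Q : (W.baseChange (ringClassField K ι n)).toAffine.Point,
              ((2 ^ (sigmaShift W Dt + 1) : ℕ) : ℤ) • Q = d.derivedPoint) →
            Nat.card (AddCommGroup.primaryComponent (W.baseChange K).sha 2) = 2 ^ (2 * (M₀ - sigmaShift W Dt))

/-! ### The algebraic core of the lever, elementary and checkable (why the TYPE, not the sign, decides) -/

/-- **Local Kummer losslessness (statement; M-sized linear algebra over `ℤ/2^M`).**  For an involution `σ` of a
free `ℤ/2^M`-module `T` of rank two (`σ = ρ(Frob_ℓ)` on `T = E[2^M]` at a level-`M` Kolyvagin prime): the image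
`(1 + σ)T` — which is where the Kummer image of every `ℚ_ℓ`-RATIONAL point lands inside
`E(K_λ)/2^M ≅ E[2^M]`, and where the prescribed evaluations of a `τ`-eigenclass at `Frob_λ = Frob_ℓ²` land —
contains an element of exact order `2^M` iff `σ` moves a `2`-torsion element (REGULAR type); if `σ ≡ 1 mod 2`
(DIAGONAL type, = `Frob ∞` when `Δ_E > 0`) it is killed by `2^{M−1}` (one bit lost per prime: Kolyvagin's
error term `d`, item 24880's «bottom bit», item 24883's residual). -/
def LocalKummerLossless : Prop :=
  ∀ (M : ℕ), 1 ≤ M → ∀ (σ : (Fin 2 → ZMod (2 ^ M)) →ₗ[ZMod (2 ^ M)] (Fin 2 → ZMod (2 ^ M))),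
    σ * σ = 1 →
      ((∃ x : Fin 2 → ZMod (2 ^ M), addOrderOf ((1 + σ) x) = 2 ^ M) ↔
        ∃ v : Fin 2 → ZMod (2 ^ M), (2 : ZMod (2 ^ M)) • v = 0 ∧ σ v ≠ v)

/-! ### Cheap direction lemmas (kernel-checked): the regular statements sit BELOW the filed ones -/

theorem kolyvaginExactAtTwoRegular_of_exact (h : KolyvaginExactAtTwo) : KolyvaginExactAtTwoRegular := by
  intro W _ _ _ hcm K _ _ hK hodd h3 hH hsq1 hsq2 hρ Dt β ι d₁ hy M₀ hdiv hndiv n d hn hreg hw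
  exact h W hcm K hK hodd h3 hH hsq1 hsq2 hρ Dt β ι d₁ hy M₀ hdiv hndiv n d hn (fun ℓ hℓ => (hreg ℓ hℓ).1) hw

/-- The patched use site of the sibling line (`bsdp_two_delta`, lines 890–892): S4ʳᵉᵍ's witness feeds S5ʳᵉᵍ
exactly as S4's fed S5 — the pair is composable with the accumulation stub S3 unchanged. -/
theorem sha_card_of_regular_pair (hK2 : StringentPrimitivityRegAtTwo) (hK3 : ShiftedKolyvaginStructureRegAtTwo)
    (W : WeierstrassCurve ℚ) [W.IsElliptic] [W.IsGloballyMinimal] [NeZero (W.conductorNorm ℤ)]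
    (hcm : ¬ W.HasCM) (hρ : ∀ n : ℕ, W.HasSurjectiveModNGaloisRep ((2 ^ n : ℕ) : ℤ)) (hr : W.analyticRank = 1)
    (K : Type) [Field K] [NumberField K] (hK : IsImaginaryQuadratic K) (hodd : Odd (NumberField.discr K))
    (h3 : NumberField.discr K ≠ -3) (hH : SatisfiesHeegnerHypothesis (W.conductorNorm ℤ) K)
    (hsq1 : ¬ IsSquare ((NumberField.discr K : ℚ) * -|W.Δ|))
    (hsq2 : ¬ IsSquare ((NumberField.discr K : ℚ) * (-(2 * |W.Δ|))))
    (Dt : ModularForms.ModularParametrizationData W (W.conductorNorm ℤ)) (β : ℤ) (ι : K →+* ℂ)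
    (d₁ : KolyvaginHeegnerData Dt β ι 1) (hy : ¬ IsOfFinAddOrder d₁.derivedPoint) (M₀ : ℕ)
    (hdiv : ∃ Q : (W.baseChange (ringClassField K ι 1)).toAffine.Point, ((2 ^ M₀ : ℕ) : ℤ) • Q = d₁.derivedPoint)
    (hndiv : ¬ ∃ Q : (W.baseChange (ringClassField K ι 1)).toAffine.Point,
      ((2 ^ (M₀ + 1) : ℕ) : ℤ) • Q = d₁.derivedPoint)
    (hacc : ∀ (n : ℕ) (d : KolyvaginHeegnerData Dt β ι n) (m : ℕ), Squarefree n →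
      (∀ ℓ ∈ n.primeFactors, Zhang2014.IsKolyvaginPrime (W.conductorNorm ℤ) W K 2 ℓ) →
      (m : ℕ∞) ≤ Zhang2014.levelIndex W 2 n → m ≤ sigmaShift W Dt →
      ∃ Q : (W.baseChange (ringClassField K ι n)).toAffine.Point, ((2 ^ m : ℕ) : ℤ) • Q = d.derivedPoint) :
    Nat.card (AddCommGroup.primaryComponent (W.baseChange K).sha 2) = 2 ^ (2 * (M₀ - sigmaShift W Dt)) := by
  obtain ⟨n, d, hn, hreg, hlev, hw⟩ := hK2 W hcm hρ hr K hK hodd h3 hH hsq1 hsq2 Dt β ι d₁ hy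
  exact hK3 W hcm hρ K hK hodd h3 hH hsq1 hsq2 Dt β ι d₁ hy M₀ hdiv hndiv hacc n d hn hreg hlev hw

end Summit.BirchSwinnertonDyer.BirchSwinnertonDyer.Cruxes.RankOneAtTwoOffBigImageOddLocal.RegularFrobeniusPrimes

end
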